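import Summits.SmoothPoincare4.SmoothPoincare4.Theorems.ZseSVanishesOnPairs.Negative.MirrorClosure
import Literature.Topology.FourManifolds.RasmussenProofs
import Literature.Topology.FourManifolds.DehnSurgeryProofs

/-!
# `s` is not a `0`-surgery invariant (unconditionally), and the topological variant of `SVanishesOnPairs` fails as soon as `s` detects one topologically slice knot (negative lemmas for crux stmt-SmoothPoincare4-0368)

Crux `ZeroSurgeryExotic.ZseSVanishesOnPairs` (item `stmt-SmoothPoincare4-0368`) = the tree's open statement
`Literature.Uncategorized.SVanishesOnPairs`.  Consequences of the mirror closure (`MirrorClosure.lean`: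
every knot is a `0`-friend of its mirror image in the tree's unoriented sense) for two natural
strengthenings that `Strengthenings.lean` (cdisprove gen 1) could refute only modulo the Conway/Piccirillo
pair:

* `not_rasmussen_zeroSurgeryInvariant` — UNCONDITIONAL: `s` is not an invariant of the `0`-surgery (in the
  tree's sense): `S³₀(T(2,3))` is `0`-surgery on `T(2,3)` (`s = 2`, proved) and on its mirror (`s = -2`,
  `HasRasmussenInvariant.mirror_holds`).  So no proof of the crux factors through "common `0`-surgery ⇒
  equal `s`"; the sliceness of `K` must be used.
* `sVanishesOnPairs_topological_false_of_sDetectsTopSlice` — the TOPOLOGICAL variant (`K` only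
  topologically slice) fails as soon as ONE topologically slice knot has `s ≠ 0` (in print: the positive
  untwisted Whitehead double of the right-handed trefoil, `Δ = 1`, `s = 2`, Rasmussen 2010 / Freedman; not
  constructible in the tree): the pair `(K, K̄, S³₀(K))`.
Standing disprover, cdisprove gen 2; no definitions; no route item concluded positively.
-/

noncomputable section

set_option linter.dupNamespace false

open scoped Manifold ContDiff
open Literature.Topology.FourManifolds Literature.Uncategorized

namespace Summit.SmoothPoincare4.SmoothPoincare4.Theorems.ZseSVanishesOnPairs.Negative

/-- `s(T̄(2,3)) = -2` for the mirror image of the tree's positive trefoil `torusKnot 2 3` (from the PROVED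
`s(T(2,3)) = 2` and `HasRasmussenInvariant.mirror_holds`). [cite: Rasmussen2010, Thm. 4] -/
theorem hasRasmussenInvariant_trefoil_mirror_neg_two :
    (torusKnot 2 3 le_rfl (by norm_num) (by decide)).mirror.HasRasmussenInvariant (-2) := by
  have h := hasRasmussenInvariant_torusKnot_holds 2 3 le_rfl (by norm_num) (by decide)
  norm_num at h
  exact HasRasmussenInvariant.mirror_holds h

/-- **`s` is NOT a `0`-surgery invariant — unconditionally**: it is false that knots with a common
`0`-surgery (tree sense) have equal Rasmussen invariants; witness `K = T(2,3)` (`t = 2`),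
`K' = T̄(2,3)` (`s = -2`), `Y = S³₀(T(2,3))`, a `0`-surgery on both (`zeroSurgeryPair_self_mirror`).
[cite: Rasmussen2010, Thm. 4] -/
theorem not_rasmussen_zeroSurgeryInvariant :
    ¬ ∀ (K K' : Knot) (Y : Type) [TopologicalSpace Y] [ChartedSpace (EuclideanSpace ℝ (Fin 3)) Y]
        (s t : ℤ), IsIntegralSurgery (𝓡 3) Y K 0 → IsIntegralSurgery (𝓡 3) Y K' 0 →
        K.HasRasmussenInvariant t → K'.HasRasmussenInvariant s → s = t := by
  intro h
  obtain ⟨Y, _, _, _, _, _, _, hY⟩ :=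
    exists_isIntegralSurgery_holds (torusKnot 2 3 le_rfl (by norm_num) (by decide)) 0
  have ht : (torusKnot 2 3 le_rfl (by norm_num) (by decide)).HasRasmussenInvariant 2 := by
    have h' := hasRasmussenInvariant_torusKnot_holds 2 3 le_rfl (by norm_num) (by decide)
    norm_num at h'
    exact h'
  have := h _ _ Y (-2) 2 hY (zeroSurgeryPair_self_mirror hY).2 ht
    hasRasmussenInvariant_trefoil_mirror_neg_two
  norm_num at this

/-- **The topological variant of the crux fails as soon as `s` detects ONE topologically slice knot**:
if some topologically slice `K` has a Rasmussen invariant `s ≠ 0` (in print: `Wh⁺(T₂,₃)`, `s = 2`,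
`Δ = 1` — Rasmussen 2010, topologically slice by Freedman; hypothesis `hW`, not constructible in the
tree), then "on `0`-surgery pairs with `K` TOPOLOGICALLY slice, `s(K') = 0`" is false: take the pair
`(K, K̄, S³₀(K))`, `s(K̄) = -s ≠ 0`. Sharpens `zseSVanishesOnPairs_topological_false_of_conwayPair`.
[cite: Rasmussen2010, Thm. 1] -/
theorem sVanishesOnPairs_topological_false_of_sDetectsTopSlice
    (hW : ∃ (K : Knot) (s : ℤ), K.IsTopologicallySlice ∧ K.HasRasmussenInvariant s ∧ s ≠ 0) :
    ¬ ∀ (K K' : Knot) (Y : Type) [TopologicalSpace Y] [ChartedSpace (EuclideanSpace ℝ (Fin 3)) Y]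
        (s : ℤ), IsIntegralSurgery (𝓡 3) Y K 0 → IsIntegralSurgery (𝓡 3) Y K' 0 →
        K.IsTopologicallySlice → K'.HasRasmussenInvariant s → s = 0 := by
  rintro h
  obtain ⟨K, s, hK, hs, hs0⟩ := hW
  obtain ⟨Y, _, _, _, _, _, _, hY⟩ := exists_isIntegralSurgery_holds K 0
  have := h K K.mirror Y (-s) hY (zeroSurgeryPair_self_mirror hY).2 hK
    (HasRasmussenInvariant.mirror_holds hs)
  omega

end Summit.SmoothPoincare4.SmoothPoincare4.Theorems.ZseSVanishesOnPairs.Negative
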